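import Literature.NumberTheory.EllipticCurves.ShintaniOrbitUnfolding
import Literature.NumberTheory.EllipticCurves.CayleyDefiniteVanishing
import Literature.NumberTheory.EllipticCurves.StripFundamentalDomain
import Literature.NumberTheory.EllipticCurves.PeterssonFdCoordinatesProofs
import HarnessLib

/-!
# The orbits of definite vectors contribute nothing to the unfolded Shintani lift

[[cite: Shintani1975, §2, proof of Prop. 2.3 (p. 103)]] — "Finally assume … `(x, x) < 0` …
`∫₀^{2π} e^{2iℓθ} dθ = 0`."  For the twisted lift on `Γ₀(64)⁺` we PROVE `∫_{F_{k₀}} term(k₀) = 0`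
for every `k₀` with `disc ι♮(k₀) < 0` (`D` odd, `φ ∈ S₂(Γ₀(64))`):

* `gAff u v`, `coe_gAff_smul` — the substitution `w ↦ v w + u` (an element of `GL₂(ℝ)⁺`),
  `integral_comp_gl_smul` (invariance of `dμ`), `exists_root_of_disc_neg` (the root `u + iv`);
* `shintaniFn_gAff_smul` — adapted to the root, `f_{vw+u,Z}(x) = (w² + 1) · A · G((|w|² + 1)/Im w)`
  with `G` a Gaussian profile;
* `integrableOn_polar_of_continuousOn` — polar integrability on the disc from continuity and
  integrability (Mathlib `lintegral_comp_polarCoord_symm`);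
* **`integral_orbitDomain_eq_zero_of_disc_neg`** — the stabiliser is trivial
  (`ShintaniLatticeAction.eq_one_of_smul_eq_of_disc_neg`), so the orbit integral is over `ℍ`;
  after the substitution the integrand is `ψ(w)(w² + 1)G(·)` with `ψ` holomorphic, and
  `CayleyDefiniteVanishing.setIntegral_uhp_definite_eq_zero` applies.

No named facts; the only definition is `gAff`.
-/

noncomputable section

open scoped MatrixGroups ModularForm Modular Topology ENNReal Pointwise Manifold
open UpperHalfPlane hiding I
open Complex Filter MeasureTheory Set CongruenceSubgroup ModularGroup Real
open Literature.NumberTheory.EllipticCurves.ModularForms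

namespace Literature.NumberTheory.EllipticCurves.Shintani

/-! ### The affine substitution `w ↦ v w + u` -/

/-- The matrix `(v u; 0 1) ∈ GL₂(ℝ)⁺` (`v > 0`), acting on `ℍ` by `w ↦ v w + u`. [folklore] -/
def gAff (u v : ℝ) (hv : 0 < v) : GL (Fin 2) ℝ :=
  Matrix.GeneralLinearGroup.mkOfDetNeZero !![v, u; 0, 1] (by rw [Matrix.det_fin_two_of]; linarith)

/-- The action: `(v u; 0 1) • w = v w + u`. [folklore] -/
theorem coe_gAff_smul (u v : ℝ) (hv : 0 < v) (w : ℍ) :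
    (((gAff u v hv) • w : ℍ) : ℂ) = (v : ℂ) * w + u := by
  unfold gAff
  rw [UpperHalfPlane.coe_smul_of_det_pos]
  · simp [UpperHalfPlane.num, UpperHalfPlane.denom, Matrix.GeneralLinearGroup.mkOfDetNeZero]
  · rw [Matrix.GeneralLinearGroup.val_det_apply]
    simp [Matrix.GeneralLinearGroup.mkOfDetNeZero, Matrix.det_fin_two_of]
    exact hv

/-- `Im (v w + u) = v Im w`. [folklore] -/
theorem gAff_smul_im (u v : ℝ) (hv : 0 < v) (w : ℍ) : ((gAff u v hv) • w).im = v * w.im := by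
  rw [← UpperHalfPlane.coe_im, coe_gAff_smul]; simp

/-! ### The form after the substitution adapted to its root -/

/-- **The kernel term at `v w + u` for the root `ω = u + iv` of a definite form**: if
`2x₀u + x₁ = 0` and `x₀u² + x₁u + x₂ = x₀v²` (i.e. `x(ω, 1) = 0`), then
`f_{vw+u, Z}(x) = (w² + 1) · G((|w|² + 1)/Im w)` with
`G(s) = x₀v² e^{2πi Re Z disc x - 2π Im Z disc x} e^{-4π Im Z x₀² v² s²}`. [folklore] -/
theorem shintaniFn_gAff_smul {x : V} {u v : ℝ} (hv : 0 < v) (h1 : 2 * x 0 * u + x 1 = 0)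
    (h2 : x 0 * u ^ 2 + x 1 * u + x 2 = x 0 * v ^ 2) (w Z : ℍ) :
    shintaniFn ((gAff u v hv) • w) Z x =
      (((w : ℂ)) ^ 2 + 1) * ((((x 0 * v ^ 2 : ℝ)) : ℂ) *
        cexp (2 * π * I * ((Z : ℂ).re * disc x + I * ((Z : ℂ).im * disc x))) *
        cexp ((-(4 * π * (Z : ℂ).im * (x 0) ^ 2 * v ^ 2 *
          ((Complex.normSq (w : ℂ) + 1) / w.im) ^ 2) : ℝ))) := by
  have hvne : v ≠ 0 := hv.ne'
  have hwim : w.im ≠ 0 := w.im_ne_zero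
  -- the value `x(vw+u, 1) = x₀ v² (w² + 1)`
  have hform : formEval x ((((gAff u v hv) • w : ℍ) : ℂ)) = ((x 0 * v ^ 2 : ℝ) : ℂ) * (((w : ℂ)) ^ 2 + 1) := by
    rw [coe_gAff_smul, formEval]
    have h1C : (2 * x 0 * u + x 1 : ℂ) = 0 := by
      have := congrArg (fun t : ℝ ↦ (t : ℂ)) h1; push_cast at this; exact this
    have h2C : (x 0 * u ^ 2 + x 1 * u + x 2 : ℂ) = x 0 * v ^ 2 := by
      have := congrArg (fun t : ℝ ↦ (t : ℂ)) h2; push_cast at this; exact this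
    push_cast
    linear_combination ((v : ℂ) * w) * h1C + h2C
  -- the majorant: `p_{vw+u}(x) = x₀ v (|w|²+1)/Im w`
  have hpw : pw ((gAff u v hv) • w) x = x 0 * v * ((Complex.normSq (w : ℂ) + 1) / w.im) := by
    rw [pw, gAff_smul_im, show ((gAff u v hv) • w).re = ((((gAff u v hv) • w : ℍ) : ℂ)).re from rfl,
      coe_gAff_smul, Complex.normSq_apply, Complex.normSq_apply]
    simp only [add_re, mul_re, ofReal_re, ofReal_im, zero_mul, sub_zero, add_im, mul_im, add_zero,
      UpperHalfPlane.coe_re, UpperHalfPlane.coe_im]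
    field_simp
    linear_combination (v * w.re) * h1 + h2
  have hmaj : majorant ((gAff u v hv) • w) x =
      disc x + 2 * (x 0 * v * ((Complex.normSq (w : ℂ) + 1) / w.im)) ^ 2 := by
    rw [majorant, hpw]
  rw [shintaniFn, hform, hmaj]
  have : (2 * π * I * (((Z : ℂ).re : ℂ) * ((disc x : ℝ) : ℂ) + I * (((Z : ℂ).im : ℂ) *
      ((disc x + 2 * (x 0 * v * ((Complex.normSq (w : ℂ) + 1) / w.im)) ^ 2 : ℝ) : ℂ))) : ℂ) =
      2 * π * I * ((Z : ℂ).re * disc x + I * ((Z : ℂ).im * disc x)) +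
        (((-(4 * π * (Z : ℂ).im * (x 0) ^ 2 * v ^ 2 * ((Complex.normSq (w : ℂ) + 1) / w.im) ^ 2) : ℝ)) : ℂ) := by
    push_cast
    ring_nf
    rw [Complex.I_sq]
    ring
  rw [this, Complex.exp_add]
  push_cast
  ring

/-- **A root of a definite form**: for `x₀ ≠ 0` and `disc x < 0`, `u = -x₁/(2x₀)`,
`v = √(-disc)/(2|x₀|) > 0` satisfy `2x₀u + x₁ = 0`, `x₀u² + x₁u + x₂ = x₀v²`. [folklore] -/
theorem exists_root_of_disc_neg {x : V} (hx0 : x 0 ≠ 0) (hdisc : disc x < 0) :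
    ∃ u v : ℝ, 0 < v ∧ 2 * x 0 * u + x 1 = 0 ∧ x 0 * u ^ 2 + x 1 * u + x 2 = x 0 * v ^ 2 := by
  set s : ℝ := Real.sqrt (-disc x) with hs
  have hs2 : s ^ 2 = -disc x := Real.sq_sqrt (by linarith)
  have hspos : 0 < s := Real.sqrt_pos.mpr (by linarith)
  have habs : 0 < |x 0| := abs_pos.mpr hx0
  refine ⟨-x 1 / (2 * x 0), s / (2 * |x 0|), by positivity, by field_simp; ring, ?_⟩
  have hd : disc x = x 1 ^ 2 - 4 * x 0 * x 2 := rfl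
  have hv2 : (s / (2 * |x 0|)) ^ 2 = s ^ 2 / (4 * x 0 ^ 2) := by
    rw [div_pow, mul_pow, sq_abs]; ring
  rw [hv2, hs2, hd]
  field_simp
  ring

/-! ### The change of variables `w = (v u; 0 1) • w'` on `ℍ` -/

/-- `∫_ℍ ψ(g • w) dμ = ∫_ℍ ψ dμ` for `g ∈ GL₂(ℝ)` (invariance of the hyperbolic measure). [folklore] -/
theorem integral_comp_gl_smul {E : Type*} [NormedAddCommGroup E] [NormedSpace ℝ E] (g : GL (Fin 2) ℝ)
    (ψ : ℍ → E) : ∫ w, ψ (g • w) = ∫ w, ψ w :=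
  (measurePreserving_smul g (volume : Measure ℍ)).integral_comp (MeasurableEquiv.smul g).measurableEmbedding ψ

/-- Integrability along the same substitution. [folklore] -/
theorem integrable_comp_gl_smul_iff {E : Type*} [NormedAddCommGroup E] (g : GL (Fin 2) ℝ) (ψ : ℍ → E) :
    Integrable (fun w ↦ ψ (g • w)) ↔ Integrable ψ :=
  (measurePreserving_smul g (volume : Measure ℍ)).integrable_comp_emb (MeasurableEquiv.smul g).measurableEmbedding

/-! ### Polar integrability on the disc from continuity and integrability -/

/-- For `F` continuous and integrable on the unit disc, the polar integrand `r F(re^{iθ})` is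
integrable on `(0,1) × (-π,π)` (Mathlib's `lintegral_comp_polarCoord_symm` for the size, continuity
for measurability). [folklore] -/
theorem integrableOn_polar_of_continuousOn {F : ℂ → ℂ} (hcont : ContinuousOn F (Metric.ball 0 1))
    (hint : IntegrableOn F (Metric.ball 0 1)) :
    IntegrableOn (fun p : ℝ × ℝ ↦ (p.1 : ℂ) * F (circleMap 0 p.1 p.2)) (Ioo (0 : ℝ) 1 ×ˢ Ioo (-π) π) := by
  have hS : MeasurableSet (Ioo (0 : ℝ) 1 ×ˢ Ioo (-π) π) := measurableSet_Ioo.prod measurableSet_Ioo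
  have hmaps : ∀ p ∈ Ioo (0 : ℝ) 1 ×ˢ Ioo (-π) π, circleMap 0 p.1 p.2 ∈ Metric.ball (0 : ℂ) 1 := by
    intro p hp
    have hr : 0 < p.1 := (mem_prod.mp hp).1.1
    rw [Metric.mem_ball, dist_zero_right, circleMap_zero, norm_mul, Complex.norm_real,
      Complex.norm_exp_ofReal_mul_I, mul_one, Real.norm_of_nonneg hr.le]
    exact (mem_prod.mp hp).1.2
  have hcm : Continuous fun p : ℝ × ℝ ↦ circleMap 0 p.1 p.2 := by
    simp only [circleMap_zero]
    fun_prop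
  refine ⟨?_, ?_⟩
  · refine ContinuousOn.aestronglyMeasurable ?_ hS
    refine (Complex.continuous_ofReal.comp continuous_fst).continuousOn.mul ?_
    exact hcont.comp hcm.continuousOn hmaps
  · -- size: compare with `∫⁻ ‖F‖ₑ` on the disc through polar coordinates
    rw [hasFiniteIntegral_iff_enorm]
    set Fb : ℂ → ℂ := (Metric.ball (0 : ℂ) 1).indicator F with hFb
    have hpol := Complex.lintegral_comp_polarCoord_symm (fun z : ℂ ↦ ‖Fb z‖ₑ)
    have hfin : ∫⁻ z : ℂ, ‖Fb z‖ₑ < ∞ := by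
      have h1 : (fun z ↦ ‖Fb z‖ₑ) = (Metric.ball (0 : ℂ) 1).indicator (fun z ↦ ‖F z‖ₑ) := by
        funext z; rw [hFb, enorm_indicator_eq_indicator_enorm]
      rw [h1, lintegral_indicator Metric.isOpen_ball.measurableSet]
      exact hint.2
    have hsub : Ioo (0 : ℝ) 1 ×ˢ Ioo (-π) π ⊆ polarCoord.target := by
      rw [polarCoord_target]; exact prod_mono Ioo_subset_Ioi_self le_rfl
    calc ∫⁻ p in Ioo (0 : ℝ) 1 ×ˢ Ioo (-π) π, ‖(p.1 : ℂ) * F (circleMap 0 p.1 p.2)‖ₑ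
        = ∫⁻ p in Ioo (0 : ℝ) 1 ×ˢ Ioo (-π) π, ENNReal.ofReal p.1 • ‖Fb (Complex.polarCoord.symm p)‖ₑ := by
          refine setLIntegral_congr_fun hS (fun p hp ↦ ?_)
          have hr : 0 < p.1 := (mem_prod.mp hp).1.1
          rw [Literature.Analysis.Complex.polarCoord_symm_eq_circleMap, hFb, indicator_of_mem (hmaps p hp),
            enorm_mul, smul_eq_mul]
          congr 1
          rw [← ofReal_norm, Complex.norm_real, Real.norm_of_nonneg hr.le]
      _ ≤ ∫⁻ p in polarCoord.target, ENNReal.ofReal p.1 • ‖Fb (Complex.polarCoord.symm p)‖ₑ :=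
          lintegral_mono_set hsub
      _ = ∫⁻ z : ℂ, ‖Fb z‖ₑ := hpol
      _ < ∞ := hfin

/-! ### The definite orbits vanish -/

/-- The affine map takes `ofComplex z` to `ofComplex (v z + u)` for `Im z > 0`. [folklore] -/
theorem gAff_smul_ofComplex {u v : ℝ} (hv : 0 < v) {z : ℂ} (hz : 0 < z.im) :
    (gAff u v hv) • UpperHalfPlane.ofComplex z = UpperHalfPlane.ofComplex ((v : ℂ) * z + u) := by
  have hz' : 0 < ((v : ℂ) * z + u).im := by simpa using mul_pos hv hz
  apply UpperHalfPlane.ext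
  rw [coe_gAff_smul, UpperHalfPlane.ofComplex_apply_of_im_pos hz, UpperHalfPlane.ofComplex_apply_of_im_pos hz']

variable (D : ℕ) [NeZero D]

/-- **The orbit of a definite vector contributes `0`**: for `D` odd, `φ ∈ S₂(Γ₀(64))` and `k₀`
with `disc ι♮(k₀) < 0`, `∫_{F_{k₀}} term(k₀) = 0` — the stabiliser is trivial
(`ShintaniLatticeAction`), so the orbit integral is over all of `ℍ`; the substitution
`w = v w' + u` adapted to the root `u + iv` of the form makes the term
`ψ(w')(w'² + 1) G((|w'|² + 1)/Im w')` with `ψ` holomorphic, which integrates to `0` through the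
disc model (`CayleyDefiniteVanishing`: Cauchy's theorem on the circles around the fixed point).
[cite: Shintani1975, §2, proof of Prop. 2.3 (p. 103)] -/
theorem integral_orbitDomain_eq_zero_of_disc_neg (hD : Odd D) (f : CuspForm (Gamma0 64) 2) (z : ℍ)
    {k₀ : Fin 3 → ℤ} (hneg : disc (latSharp k₀) < 0) :
    ∫ w in orbitDomain k₀, liftTerm D f z k₀ w = 0 := by
  -- trivial stabiliser, fundamental domain `ℍ`
  haveI : Subsingleton (stabK k₀) := ⟨fun a b ↦ Subtype.ext
    ((eq_one_of_smul_eq_of_disc_neg hneg a.2).trans (eq_one_of_smul_eq_of_disc_neg hneg b.2).symm)⟩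
  have hFD := isFundamentalDomain_orbitDomain k₀
  have hFD' : IsFundamentalDomain (stabK k₀) (univ : Set ℍ) (volume : Measure ℍ) :=
    isFundamentalDomain_univ_of_subsingleton
  have hinv : ∀ (γ : stabK k₀) (w : ℍ), liftTerm D f z k₀ (γ • w) = liftTerm D f z k₀ w :=
    liftTerm_stab_invariant D hD f z k₀
  obtain ⟨hint, -⟩ := tsum_quotient_integral_liftTerm_eq hD f z k₀
  rw [hFD.setIntegral_eq hFD' hinv, Measure.restrict_univ]
  have hintU : Integrable (liftTerm D f z k₀) := by
    have := (hFD.integrableOn_iff hFD' hinv).mp hint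
    rwa [integrableOn_univ] at this
  -- the form and its root
  set x : V := latSharp k₀ with hxdef
  have hx0 : x 0 ≠ 0 := by
    intro h0
    have : disc x = x 1 ^ 2 := by rw [disc, h0]; ring
    rw [this] at hneg
    nlinarith [sq_nonneg (x 1)]
  obtain ⟨u, v, hv, h1, h2⟩ := exists_root_of_disc_neg hx0 hneg
  -- substitute `w = (v u; 0 1) • w'`
  rw [← integral_comp_gl_smul (gAff u v hv)]
  have hintG : Integrable fun w ↦ liftTerm D f z k₀ ((gAff u v hv) • w) :=
    (integrable_comp_gl_smul_iff _ _).mpr hintU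
  -- the constants
  set Z : ℍ := zScaled D z with hZ
  set A : ℂ := ((x 0 * v ^ 2 : ℝ) : ℂ) * cexp (2 * π * I * ((Z : ℂ).re * disc x + I * ((Z : ℂ).im * disc x))) with hA
  set G : ℝ → ℂ := fun s ↦ cexp ((-(4 * π * (Z : ℂ).im * (x 0) ^ 2 * v ^ 2 * s ^ 2) : ℝ)) with hG
  set ψ : ℂ → ℂ := fun w ↦ f ((gAff u v hv) • UpperHalfPlane.ofComplex w) * (cD D k₀ * A) with hψ
  -- pointwise form of the substituted term
  have hpt : ∀ w : ℍ, liftTerm D f z k₀ ((gAff u v hv) • w) =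
      ψ w * (((w : ℂ)) ^ 2 + 1) * G ((Complex.normSq (w : ℂ) + 1) / w.im) := by
    intro w
    rw [liftTerm, ← hZ, ← hxdef, shintaniFn_gAff_smul hv h1 h2 w Z, hψ, hG, hA]
    simp only [UpperHalfPlane.ofComplex_apply]
    ring
  simp_rw [hpt] at hintG ⊢
  -- to the coordinates of `ℂ`
  rw [← setIntegral_univ, FdCoord.setIntegral_eq_setIntegral_image _ MeasurableSet.univ, image_univ,
    UpperHalfPlane.range_coe]
  have hintC := (FdCoord.integrableOn_image_iff
    (fun w : ℍ ↦ ψ w * (((w : ℂ)) ^ 2 + 1) * G ((Complex.normSq (w : ℂ) + 1) / w.im)) MeasurableSet.univ).mpr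
    (by rwa [integrableOn_univ])
  rw [image_univ, UpperHalfPlane.range_coe] at hintC
  -- the integrand in the shape of `CayleyDefiniteVanishing`
  have hshape : ∀ w ∈ {z : ℂ | 0 < z.im},
      ((1 / w.im ^ 2 : ℝ) : ℂ) * (ψ (UpperHalfPlane.ofComplex w) * ((((UpperHalfPlane.ofComplex w : ℍ) : ℂ)) ^ 2 + 1) *
        G ((Complex.normSq ((UpperHalfPlane.ofComplex w : ℍ) : ℂ) + 1) / (UpperHalfPlane.ofComplex w).im)) =
      ((1 / w.im ^ 2 : ℝ) : ℂ) * (ψ w * (w ^ 2 + 1) * G ((Complex.normSq w + 1) / w.im)) := by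
    intro w hw
    have hw' : 0 < w.im := hw
    rw [UpperHalfPlane.ofComplex_apply_of_im_pos hw']
    rfl
  rw [setIntegral_congr_fun (isOpen_lt continuous_const Complex.continuous_im).measurableSet hshape]
  have hintC' : IntegrableOn (fun w : ℂ ↦ ((1 / w.im ^ 2 : ℝ) : ℂ) * (ψ w * (w ^ 2 + 1) *
      G ((Complex.normSq w + 1) / w.im))) {z : ℂ | 0 < z.im} :=
    hintC.congr_fun hshape (isOpen_lt continuous_const Complex.continuous_im).measurableSet
  -- `ψ` is holomorphic on `Im > 0`
  have hψdiff : DifferentiableOn ℂ ψ {z : ℂ | 0 < z.im} := by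
    have hf : DifferentiableOn ℂ (⇑f ∘ UpperHalfPlane.ofComplex) {z : ℂ | 0 < z.im} :=
      UpperHalfPlane.mdifferentiable_iff.mp (CuspFormClass.holo f)
    have haff : DifferentiableOn ℂ (fun w : ℂ ↦ (v : ℂ) * w + u) {z : ℂ | 0 < z.im} := by fun_prop
    have hmaps : MapsTo (fun w : ℂ ↦ (v : ℂ) * w + u) {z : ℂ | 0 < z.im} {z : ℂ | 0 < z.im} := by
      intro w hw
      show 0 < ((v : ℂ) * w + u).im
      simpa using mul_pos hv hw
    have hcomp := hf.comp haff hmaps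
    refine ((hcomp.mul_const (cD D k₀ * A)).congr fun w hw ↦ ?_)
    simp only [hψ, Function.comp_apply]
    rw [gAff_smul_ofComplex hv hw]
  -- conclude by the disc lemma; it remains to provide integrability in polar form
  refine setIntegral_uhp_definite_eq_zero hψdiff G ?_
  -- from `hintC'` through the Cayley change of variables and polar coordinates
  have hball := (integrableOn_uhp_iff_integrableOn_ball _).mp hintC'
  set H : ℝ → ℂ := fun r ↦ -8 * G (2 * (1 + r ^ 2) / (1 - r ^ 2)) / (((1 - r ^ 2) ^ 2 : ℝ) : ℂ) / I with hH
  set Ψ : ℂ → ℂ := fun ζ ↦ ψ (cayInv ζ) * (2 * I / (1 - ζ) ^ 2) with hΨ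
  have hball' : IntegrableOn (fun ζ ↦ H ‖ζ‖ * (ζ * Ψ ζ)) (Metric.ball (0 : ℂ) 1) := by
    refine hball.congr_fun (fun ζ hζ ↦ ?_) Metric.isOpen_ball.measurableSet
    rw [hH, hΨ]
    exact disc_integrand_eq ψ G hζ
  -- continuity on the disc
  have hGc : Continuous G := by rw [hG]; fun_prop
  have hψc : ContinuousOn ψ {z : ℂ | 0 < z.im} := hψdiff.continuousOn
  have hcay : ContinuousOn cayInv (Metric.ball (0 : ℂ) 1) := by
    intro ζ hζ
    exact (hasDerivAt_cayInv (one_sub_ne_zero_of_mem_ball hζ)).continuousAt.continuousWithinAt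
  have hcont : ContinuousOn (fun ζ ↦ H ‖ζ‖ * (ζ * Ψ ζ)) (Metric.ball (0 : ℂ) 1) := by
    refine ContinuousOn.mul ?_ (continuousOn_id.mul ?_)
    · rw [hH]
      refine ContinuousOn.div_const ?_ _
      refine ContinuousOn.div ?_ ?_ (fun ζ hζ ↦ ?_)
      · refine continuousOn_const.mul (hGc.comp_continuousOn ?_)
        refine ContinuousOn.div (by fun_prop) (by fun_prop) (fun ζ hζ ↦ ?_)
        rw [Metric.mem_ball, dist_zero_right] at hζ
        nlinarith [norm_nonneg ζ]
      · fun_prop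
      · rw [Metric.mem_ball, dist_zero_right] at hζ
        have : (1 : ℝ) - ‖ζ‖ ^ 2 ≠ 0 := by nlinarith [norm_nonneg ζ]
        exact_mod_cast pow_ne_zero 2 this
    · rw [hΨ]
      refine ContinuousOn.mul (hψc.comp hcay (fun ζ hζ ↦ cayInv_im_pos hζ)) ?_
      refine ContinuousOn.div continuousOn_const (by fun_prop) (fun ζ hζ ↦ ?_)
      exact pow_ne_zero 2 (one_sub_ne_zero_of_mem_ball hζ)
  have hpol := integrableOn_polar_of_continuousOn hcont hball'
  refine hpol.congr_fun (fun p hp ↦ ?_) (measurableSet_Ioo.prod measurableSet_Ioo)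
  have hr : 0 < p.1 := (mem_prod.mp hp).1.1
  have hn : ‖circleMap 0 p.1 p.2‖ = p.1 := by
    rw [circleMap_zero, norm_mul, Complex.norm_real, Complex.norm_exp_ofReal_mul_I, mul_one,
      Real.norm_of_nonneg hr.le]
  simp only [hn, hH, hΨ]

end Literature.NumberTheory.EllipticCurves.Shintani
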